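import Summits.Ventures.PackingBounds.Configurations.TightDesigns
import Summits.Ventures.PackingBounds.Configurations.CrossPolytopeUnique
import Summits.Ventures.PackingBounds.Configurations.IcosahedronUnique
import Summits.Ventures.PackingBounds.Energy.UniversalOptimalityCrossPolytope

/-!
# Tight `2`-, `3`- and `5`-designs: simplices, cross-polytopes and the icosahedron (design forms of uniqueness)

Framing: lottery ticket; floor = certified bounds/negative ranges. Venture `PackingBounds` (cell
`pub-packcert`, seat `pub-packcert-energy`) — continuation of `TightDesigns`.

Classical facts of Delsarte–Goethals–Seidel, in the tree's moment vocabulary (`Σ_{x,y} C_k^{(μ)}(⟪x,y⟫) = 0` for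
`1 ≤ k ≤ t`, `n = 2μ + 2 ≥ 3`), each via `TightDesign.offDiag_eq_zero_of_design`:

* `inner_eq_of_design2`: an `(n+1)`-point `2`-design in `S^{n-1}` has all inner products `-1/n` — a regular simplex
  (annihilator `(t + 1/n)²`); any two are isometric (`isometric_of_design2`, via `Config.isometric_of_inner_const`);
* `inner_mem_of_design3`: a `2n`-point `3`-design in `S^{n-1}` has inner products in `{-1, 0}` — a cross-polytope
  (annihilator `(t+1)t²`); any two are isometric (`isometric_of_design3`, via `CrossPolytopeUnique`);
* `isometric_icosahedron_of_design5`: a `12`-point `5`-design on `S²` is an isometric image of the regular icosahedron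
  `Config.Icosahedron.pts` (annihilator `(t+1)(t² - 1/5)²`, `g_0 = 8/75`; `IcosahedronUnique`).

## References
* P. Delsarte, J.-M. Goethals, J. J. Seidel, *Spherical codes and designs*, Geom. Dedicata 6 (1977) 363–388 (tight designs).
* H. Cohn, A. Kumar, J. Amer. Math. Soc. 20 (2007) 99–148, Table 1 and Appendix A. [`CohnKumar2006`]
-/

noncomputable section

namespace Summit.Ventures.PackingBounds.Config.TightDesignLow

open Finset Literature.Analysis.SpecialFunctions Literature.Geometry.DiscreteGeometry

/-! ### Tight `2`-designs are regular simplices -/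

/-- **An `(n+1)`-point `2`-design in `S^{n-1}` is a regular simplex**: all inner products equal `-1/n`.
[cite: CohnKumar2006, Table 1] -/
theorem inner_eq_of_design2 {n : ℕ} {μ : ℝ} (hn : (n : ℝ) = 2 * μ + 2) (hμ : 0 < μ)
    {C : Finset (EuclideanSpace ℝ (Fin n))} (h1 : ∀ x ∈ C, ‖x‖ = 1) (hN : C.card = n + 1)
    (hdes : ∀ k, 1 ≤ k → k ≤ 2 → ∑ x ∈ C, ∑ y ∈ C, gegenbauerSum μ k (inner ℝ x y) = 0)
    {x y : EuclideanSpace ℝ (Fin n)} (hx : x ∈ C) (hy : y ∈ C) (hxy : x ≠ y) :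
    inner ℝ x y = -1 / (n : ℝ) := by
  have hn0 : (n : ℝ) ≠ 0 := by rw [hn]; positivity
  have hμ1 : (μ + 1) ≠ 0 := by positivity
  have h0 := TightDesign.offDiag_eq_zero_of_design μ C h1 2
    (fun k => match k with
      | 0 => 1 / (2 * (μ + 1)) + 1 / (n : ℝ) ^ 2 | 1 => 1 / ((n : ℝ) * μ) | 2 => 1 / (2 * μ * (μ + 1)) | _ => 0)
    (fun s => (s + 1 / (n : ℝ)) ^ 2) ?_ hdes (fun x _ y _ _ => sq_nonneg _) ?_ x hx y hy hxy
  · have := pow_eq_zero_iff two_ne_zero |>.mp h0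
    rw [neg_div]
    linarith
  · intro s
    simp only [Finset.sum_range_succ, Finset.sum_range_zero, gegenbauerSum_zero, gegenbauerSum_one,
      Energy.gegenbauerSum_two, zero_add]
    rw [hn]
    field_simp
    ring
  · rw [hN]
    push_cast
    rw [hn]
    field_simp

/-- **Tight `2`-designs are unique**: any two `(n+1)`-point `2`-designs in `S^{n-1}` are isometric (regular simplices).
[cite: CohnKumar2006, Table 1] -/
theorem isometric_of_design2 {n : ℕ} {μ : ℝ} (hn : (n : ℝ) = 2 * μ + 2) (hμ : 0 < μ)
    {C C' : Finset (EuclideanSpace ℝ (Fin n))} (h1 : ∀ x ∈ C, ‖x‖ = 1) (hN : C.card = n + 1)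
    (hdes : ∀ k, 1 ≤ k → k ≤ 2 → ∑ x ∈ C, ∑ y ∈ C, gegenbauerSum μ k (inner ℝ x y) = 0)
    (h1' : ∀ x ∈ C', ‖x‖ = 1) (hN' : C'.card = n + 1)
    (hdes' : ∀ k, 1 ≤ k → k ≤ 2 → ∑ x ∈ C', ∑ y ∈ C', gegenbauerSum μ k (inner ℝ x y) = 0) :
    ∃ Ψ : EuclideanSpace ℝ (Fin n) ≃ₗᵢ[ℝ] EuclideanSpace ℝ (Fin n), C' = C.image Ψ :=
  isometric_of_inner_const C C' (-1 / (n : ℝ)) h1 (fun _ hx _ hy hxy => inner_eq_of_design2 hn hμ h1 hN hdes hx hy hxy)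
    h1' (fun _ hx _ hy hxy => inner_eq_of_design2 hn hμ h1' hN' hdes' hx hy hxy) (by rw [hN, hN'])

/-! ### Tight `3`-designs are cross-polytopes -/

/-- **A `2n`-point `3`-design in `S^{n-1}` has all inner products in `{-1, 0}`** (it is a cross-polytope).
[cite: CohnKumar2006, Table 1] -/
theorem inner_mem_of_design3 {n : ℕ} {μ : ℝ} (hn : (n : ℝ) = 2 * μ + 2) (hμ : 0 < μ)
    {C : Finset (EuclideanSpace ℝ (Fin n))} (h1 : ∀ x ∈ C, ‖x‖ = 1) (hN : C.card = 2 * n)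
    (hdes : ∀ k, 1 ≤ k → k ≤ 3 → ∑ x ∈ C, ∑ y ∈ C, gegenbauerSum μ k (inner ℝ x y) = 0)
    {x y : EuclideanSpace ℝ (Fin n)} (hx : x ∈ C) (hy : y ∈ C) (hxy : x ≠ y) :
    inner ℝ x y = -1 ∨ inner ℝ x y = 0 := by
  have hμ1 : (μ + 1) ≠ 0 := by positivity
  have hμ2 : (μ + 2) ≠ 0 := by positivity
  have h0 := TightDesign.offDiag_eq_zero_of_design μ C h1 3
    (fun k => match k with
      | 0 => 1 / (2 * (μ + 1)) | 1 => 3 / (4 * μ * (μ + 2)) | 2 => 1 / (2 * μ * (μ + 1))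
      | 3 => 3 / (4 * μ * (μ + 1) * (μ + 2)) | _ => 0)
    (fun s => (s + 1) * s ^ 2) ?_ hdes ?_ ?_ x hx y hy hxy
  · rcases mul_eq_zero.mp h0 with h | h
    · left; linarith
    · right; exact pow_eq_zero_iff two_ne_zero |>.mp h
  · intro s
    simp only [Finset.sum_range_succ, Finset.sum_range_zero, gegenbauerSum_zero, gegenbauerSum_one,
      Energy.gegenbauerSum_two, Energy.UniversalCrossPolytope.gegenbauerSum_three, zero_add]
    field_simp
    ring
  · intro x hx y hy _
    have hb := abs_real_inner_le_norm x y
    rw [h1 x hx, h1 y hy, one_mul] at hb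
    exact mul_nonneg (by linarith [(abs_le.mp hb).1]) (sq_nonneg _)
  · rw [hN]
    push_cast
    rw [hn]
    field_simp
    ring

/-- **Tight `3`-designs are unique**: any two `2n`-point `3`-designs in `S^{n-1}` (`n ≥ 3`) are isometric
(cross-polytopes). [cite: CohnKumar2006, Table 1] -/
theorem isometric_of_design3 {n : ℕ} {μ : ℝ} (hn : (n : ℝ) = 2 * μ + 2) (hμ : 0 < μ) (hn3 : 3 ≤ n)
    {C C' : Finset (EuclideanSpace ℝ (Fin n))} (h1 : ∀ x ∈ C, ‖x‖ = 1) (hN : C.card = 2 * n)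
    (hdes : ∀ k, 1 ≤ k → k ≤ 3 → ∑ x ∈ C, ∑ y ∈ C, gegenbauerSum μ k (inner ℝ x y) = 0)
    (h1' : ∀ x ∈ C', ‖x‖ = 1) (hN' : C'.card = 2 * n)
    (hdes' : ∀ k, 1 ≤ k → k ≤ 3 → ∑ x ∈ C', ∑ y ∈ C', gegenbauerSum μ k (inner ℝ x y) = 0) :
    ∃ Ψ : EuclideanSpace ℝ (Fin n) ≃ₗᵢ[ℝ] EuclideanSpace ℝ (Fin n), C' = C.image Ψ := by
  refine CrossPolytopeUnique.isometric_of_crossPolytope_codes hn3 C C' h1 (fun x hx y hy hxy => ?_) hN h1'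
    (fun x hx y hy hxy => ?_) hN'
  · rcases inner_mem_of_design3 hn hμ h1 hN hdes hx hy hxy with h | h <;> simp [h]
  · rcases inner_mem_of_design3 hn hμ h1' hN' hdes' hx hy hxy with h | h <;> simp [h]

/-! ### Tight `5`-designs on `S²`: the icosahedron -/

/-- The annihilator `(t+1)(t² - 1/5)²` in the Legendre basis (`μ = 1/2`). -/
private theorem hpoly_ico (s : ℝ) : (s + 1) * (s ^ 2 - 1 / 5) ^ 2 =
    ∑ k ∈ range (5 + 1), (fun k => match k with
      | 0 => 8 / 75 | 1 => 8 / 35 | 2 => 32 / 105 | 3 => 64 / 225 | 4 => 8 / 35 | 5 => 8 / 63 | _ => 0) k *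
      gegenbauerSum ((1 / 2 : ℝ)) k s := by
  simp [Finset.sum_range_succ, gegenbauerSum, gegenbauerCoeff, Finset.prod_range_succ, Nat.factorial]
  ring

/-- **A `12`-point `5`-design on `S²` has inner products in `{-1} ∪ {t² = 1/5}`.** [cite: CohnKumar2006, Table 1] -/
theorem inner_mem_of_design5 {C : Finset (EuclideanSpace ℝ (Fin 3))} (h1 : ∀ x ∈ C, ‖x‖ = 1) (hN : C.card = 12)
    (hdes : ∀ k, 1 ≤ k → k ≤ 5 → ∑ x ∈ C, ∑ y ∈ C, gegenbauerSum ((1 / 2 : ℝ)) k (inner ℝ x y) = 0)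
    {x y : EuclideanSpace ℝ (Fin 3)} (hx : x ∈ C) (hy : y ∈ C) (hxy : x ≠ y) :
    inner ℝ x y = -1 ∨ inner ℝ x y ^ 2 = 1 / 5 := by
  have h0 := TightDesign.offDiag_eq_zero_of_design (1 / 2) C h1 5
    (fun k => match k with
      | 0 => 8 / 75 | 1 => 8 / 35 | 2 => 32 / 105 | 3 => 64 / 225 | 4 => 8 / 35 | 5 => 8 / 63 | _ => 0)
    (fun s => (s + 1) * (s ^ 2 - 1 / 5) ^ 2) hpoly_ico hdes
    (fun x hx y hy _ => by
      have hb := abs_real_inner_le_norm x y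
      rw [h1 x hx, h1 y hy, one_mul] at hb
      exact mul_nonneg (by linarith [(abs_le.mp hb).1]) (sq_nonneg _))
    (by rw [hN]; norm_num) x hx y hy hxy
  rcases mul_eq_zero.mp h0 with h | h
  · left; linarith
  · right; have := pow_eq_zero_iff two_ne_zero |>.mp h; linarith

/-- **Tight `5`-designs on `S²` are regular icosahedra**: every `12`-point `5`-design on `S²` is an isometric image
of `Config.Icosahedron.pts`. [cite: CohnKumar2006, Appendix A] -/
theorem isometric_icosahedron_of_design5 {C : Finset (EuclideanSpace ℝ (Fin 3))} (h1 : ∀ x ∈ C, ‖x‖ = 1)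
    (hN : C.card = 12)
    (hdes : ∀ k, 1 ≤ k → k ≤ 5 → ∑ x ∈ C, ∑ y ∈ C, gegenbauerSum ((1 / 2 : ℝ)) k (inner ℝ x y) = 0) :
    ∃ Ψ : EuclideanSpace ℝ (Fin 3) ≃ₗᵢ[ℝ] EuclideanSpace ℝ (Fin 3), C = Icosahedron.pts.image Ψ :=
  IcosahedronUnique.isometric_icosahedron h1 hN fun _ hx _ hy hxy => inner_mem_of_design5 h1 hN hdes hx hy hxy

end Summit.Ventures.PackingBounds.Config.TightDesignLow

end
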